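import Literature.NumberTheory.EllipticCurves.PoonenRainsTateForm
import Literature.NumberTheory.EllipticCurves.PoonenRainsTransport
import Literature.NumberTheory.EllipticCurves.WeilPairingProofs
import HarnessLib

/-!
# The commutator pairing of the level-`2` Heisenberg group IS the divisor-theoretic Weil pairing `e₂`

The tree has two constructions of the level-`2` Weil pairing with values in `K̄`: the divisor-theoretic
`WeierstrassCurve.weilPairingFun` (Silverman III.§8, `e_m(S,T) = g(X+S)/g(X)`, `WeilPairingProofs.lean`) and the
commutator pairing of the Heisenberg (theta) group `ThetaLevelTwo.prWeil` (Poonen–Rains Prop. 4.5 (c),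
`PoonenRainsTateForm.lean`).  On `E[2]` they COINCIDE (`prWeil_eq_weilPairingFun`): a non-degenerate alternating
bimultiplicative pairing on `E[2] ≅ 𝔽₂²` with values in `μ₂` is unique — it is `−1` exactly on pairs of distinct nonzero
points (`weilPairingFun_of_ne`).  References: [SilvermanAEC2009] Prop. III.8.1; [PoonenRains2012] Prop. 4.5 (c).
No named fact is introduced.
-/

set_option autoImplicit false

noncomputable section

open scoped Classical

namespace Literature.NumberTheory.EllipticCurves

namespace ThetaLevelTwo

open _root_.WeierstrassCurve Field
open Literature.NumberTheory.EllipticCurves.DokchitserDokchitser2012 (T eq_zero_or_eq_T coe_T_ne_zero)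

universe u

variable {K : Type u} [Field K] (W : WeierstrassCurve K) [W.IsElliptic] (h2 : (2 : K) ≠ 0)

omit [W.IsElliptic] in
include h2 in
/-- The level hypothesis of `weilPairingFun` at `m = 2`. [cite: SilvermanAEC2009, III.§8 (m prime to char)] -/
theorem two_cast_ne_zero : ((2 : ℕ) : K) ≠ 0 := by exact_mod_cast h2

omit [W.IsElliptic] in
/-- Points of `E[2]` are killed by `2`. [cite: SilvermanAEC2009, III.§7 (E[m])] -/
theorem two_smul_coe_eq_zero (S : geomTorsion W 2) : ((2 : ℕ) : ℤ) • (S : geomPoints W) = 0 :=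
  (mem_torsionPoints_iff _ _ (S : geomPoints W)).mp S.2

/-- **The divisor-theoretic `e₂` is `−1` on distinct nonzero `2`-torsion points** (uniqueness of the non-degenerate
alternating pairing on `𝔽₂²`): if `e₂(P, Q)` were `1`, then `e₂(·, Q)` would be trivial on `{O, Q, P, P + Q} = E[2]`,
contradicting non-degeneracy. [cite: SilvermanAEC2009, Prop. III.8.1 (a)–(c)] -/
theorem weilPairingFun_of_ne {P Q : geomTorsion W 2} (hP : P ≠ 0) (hQ : Q ≠ 0) (hPQ : P ≠ Q) :
    weilPairingFun (two_cast_ne_zero h2) (P : geomPoints W) (Q : geomPoints W) = -1 := by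
  have hm := two_cast_ne_zero (K := K) h2
  have h2P := two_smul_coe_eq_zero W P
  have h2Q := two_smul_coe_eq_zero W Q
  -- values in `μ₂`
  have hsq := weilPairingFun_pow hm h2P h2Q
  have h1or : weilPairingFun hm (P : geomPoints W) (Q : geomPoints W) = 1
      ∨ weilPairingFun hm (P : geomPoints W) (Q : geomPoints W) = -1 :=
    mul_self_eq_one_iff.mp (by rw [← pow_two]; exact hsq)
  rcases h1or with h1 | h1
  swap
  · exact h1
  -- `e(·, Q) = 1` on all of `E[2]`, contradiction with non-degeneracy
  exfalso
  apply hQ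
  have hself := weilPairingFun_self hm h2Q
  have hzero := weilPairingFun_zero_left hm h2Q
  have key : ∀ R : geomPoints W, ((2 : ℕ) : ℤ) • R = 0 → weilPairingFun hm R (Q : geomPoints W) = 1 := by
    intro R hR
    -- `R ∈ E[2] = {O, P, Q, P + Q}`
    set R' : geomTorsion W 2 := ⟨R, (mem_torsionPoints_iff _ _ R).mpr hR⟩
    have hR' : (R' : geomPoints W) = R := rfl
    rcases eq_zero_or_eq_T W h2 R' with h0 | ⟨i, hi⟩
    · rw [← hR', h0, ZeroMemClass.coe_zero]; exact hzero
    rcases eq_zero_or_eq_T W h2 P with hP0 | ⟨a, ha⟩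
    · exact absurd hP0 hP
    rcases eq_zero_or_eq_T W h2 Q with hQ0 | ⟨b, hb⟩
    · exact absurd hQ0 hQ
    have hab : a ≠ b := fun h => hPQ (by rw [ha, hb, h])
    by_cases hib : i = b
    · rw [← hR', hi, hib, ← hb]; exact hself
    by_cases hia : i = a
    · rw [← hR', hi, hia, ← ha]; exact h1
    -- the third point: `T_i = T_a + T_b`
    obtain ⟨c, hc, hca, hcb⟩ := exists_third a b hab
    have hic : i = c := by
      have : ∀ a b c i : Fin 3, a ≠ b → c ≠ a → c ≠ b → i ≠ a → i ≠ b → i = c := by decide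
      exact this a b c i hab hca hcb hia hib
    have hsum : (T W h2 i : geomPoints W) = (P : geomPoints W) + (Q : geomPoints W) := by
      rw [hic, ← T_add_T W h2 hc, ha, hb]; rfl
    rw [← hR', hi, hsum, weilPairingFun_add_left hm h2P h2Q h2Q, h1, hself, one_mul]
  exact Subtype.ext (eq_zero_of_weilPairingFun_eq_one hm h2Q key)

/-- **The two Weil pairings agree on `E[2]`**: the commutator pairing of the Heisenberg group (`prWeil`,
Poonen–Rains Prop. 4.5 (c)) equals Silverman's divisor-theoretic `e₂` (`weilPairingFun`).
[cite: PoonenRains2012, Prop. 4.5 (c) (the commutator pairing of the Heisenberg group is e_λ)]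
[cite: SilvermanAEC2009, Prop. III.8.1] -/
theorem prWeil_eq_weilPairingFun (P Q : geomTorsion W 2) :
    prWeil W h2 P Q = weilPairingFun (two_cast_ne_zero h2) (P : geomPoints W) (Q : geomPoints W) := by
  have hm := two_cast_ne_zero (K := K) h2
  by_cases hP : P = 0
  · subst hP
    rw [prWeil_zero_left, ZeroMemClass.coe_zero, weilPairingFun_zero_left hm (two_smul_coe_eq_zero W Q)]
  by_cases hQ : Q = 0
  · subst hQ
    rw [prWeil_zero_right, ZeroMemClass.coe_zero]
    -- `e(P, O) = 1`: from additivity in the second variable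
    have h := weilPairingFun_add_right hm (two_smul_coe_eq_zero W P) (smul_zero _) (smul_zero _)
    rw [add_zero] at h
    have hsq := weilPairingFun_pow hm (two_smul_coe_eq_zero W P) (smul_zero ((2 : ℕ) : ℤ))
    have hne : weilPairingFun hm (P : geomPoints W) 0 ≠ 0 := fun h0 => by
      rw [h0, zero_pow two_ne_zero] at hsq; exact zero_ne_one hsq
    exact (mul_right_eq_self₀.mp h.symm).resolve_right hne |>.symm
  by_cases hPQ : P = Q
  · subst hPQ
    rw [prWeil_self, weilPairingFun_self hm (two_smul_coe_eq_zero W P)]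
  rw [prWeil_of_ne W h2 hP hQ hPQ, weilPairingFun_of_ne W h2 hP hQ hPQ]

end ThetaLevelTwo

end Literature.NumberTheory.EllipticCurves
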